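import Mathlib
import HarnessLib
import Summits.HubbardSuperconductivity.HubbardSuperconductivity.Theorems.KLProgrammeMatsubaraSliceBubbleTransfer

/-!
# Route `KLProgramme` — crux K3 split, ENGINE child (`KLRegimeEngineV11` stmt-HubbardSuperconductivity-19823): the transfer perturbation for the
# CROSS-SCALE pair of lines `(n, n−1)` — second line's weight supported out to radius `16Λ_n = 4Λ_{n−1}`
# (cell gate-hubbard-kl, seat hubbard-kl-k3c2-p2 «thermal-bar induction n ≤ nScales β + 1»)

The one-step increment at scale `n` contains, besides the same-slice bubble `C_n ⊗ C_n`, the cross bubbles `C_n ⊗ C_m`, `m < n` (one line of the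
slice being integrated, the other inside the tree part of the six-leg kernel created at step `m`).  At zero transfer only `m = n − 1` meets the support
of `C_n`; at small transfer (`|q₀| + δ_max < 4Λ_n`) still only `m = n − 1`.  Its weight `f' = f_{n−1}` (or `f_n + 2f_{n−1}`) is supported in
`Λ_{n−1}²/4 < s < 16Λ_{n−1}²`, i.e. out to radius `16Λ_n` — outside the hypothesis `f' = 0` for `s ≥ (4Λ_n)²` of `klsp_slice_bubble_shift_norm_le`.
This module is that lemma with the second line's outer radius `16Λ_n` (inner radius hypothesis unchanged, `f' = 0` for `s ≤ (Λ_n/2)²`, weaker than the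
truth): `klsp_slice_bubble_shift_norm_le_cross`, constant `(1024/π)·M_f·(768ℓ' + 3073M_f')·B_W·(|q₀| + δ_max)/Λ_n` (the joint Lipschitz constant of the
second propagator grows with the square of its support radius).  The zero-transfer part of the cross term is `klte_slice_bubble_weighted_norm_le` with
`F = f_n·f_{n−1}` (supported inside `(Λ_n/2, 4Λ_n)` since `f_n` is).  Pure analysis.
-/

noncomputable section

namespace Summit.HubbardSuperconductivity.HubbardSuperconductivity.Theorems.KLRegimeSplit

set_option linter.dupNamespace false -- summit = problem name (single-conjunct summit), D-0017

open Real Finset MeasureTheory Complex Literature.MathematicalPhysics.QuantumLattice Literature.Probability.LatticeModels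
open Summit.HubbardSuperconductivity.HubbardSuperconductivity.Theorems.KLProgrammeLegKernels

section Cross

variable {f f' : ℝ → ℂ} {Mf Lf' Mf' ℓ' : ℝ} {W : ℝ → ℂ} {δ : ℝ → ℝ} {BW δmax : ℝ}

/-- **The transfer perturbation for the cross-scale pair `(n, n−1)`, in scale form.**  As `klsp_slice_bubble_shift_norm_le`, but the second line's
weight `f'` may be supported out to `s < (16Λ_n)²` (`= (4Λ_{n−1})²`): at scale `n ≤ n_β + 1`,
`‖β⁻¹ • Σ_i ∫ W(e)·Φ(ω_i,e)·(Ψ(ω_i+q₀, e+δ(e)) − Ψ(ω_i,e)) de‖ ≤ (1024/π)·M_f·(768ℓ' + 3073M_f')·B_W·(|q₀| + δ_max)/Λ_n`. -/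
theorem klsp_slice_bubble_shift_norm_le_cross (hbd : ∀ s, ‖f s‖ ≤ Mf) {n : ℕ}
    (hin : ∀ s, s ≤ (klScale klE0 n / 2) ^ 2 → f s = 0) (hout : ∀ s, (4 * klScale klE0 n) ^ 2 ≤ s → f s = 0)
    (hlip' : ∀ s s', ‖f' s - f' s'‖ ≤ Lf' * |s - s'|) (hbd' : ∀ s, ‖f' s‖ ≤ Mf') (hLf' : Lf' ≤ ℓ' / klScale klE0 n ^ 2)
    (hin' : ∀ s, s ≤ (klScale klE0 n / 2) ^ 2 → f' s = 0) (hout' : ∀ s, (16 * klScale klE0 n) ^ 2 ≤ s → f' s = 0)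
    (hBW : 0 ≤ BW) (hWbd : ∀ e, |e| < 4 * klScale klE0 n → ‖W e‖ ≤ BW) (hδ0 : 0 ≤ δmax) (hδ : ∀ e, |δ e| ≤ δmax)
    (q₀ : ℝ) {β : ℝ} (hβ : klBetaMin ≤ β) (hn : n ≤ nScales β + 1) (M : ℕ) :
    ‖β⁻¹ • ∑ i : MatsubaraIdx M, ∫ e,
        W e * (f (matsubaraFreq β M i ^ 2 + e ^ 2) / (((matsubaraFreq β M i ^ 2 + e ^ 2 : ℝ)) : ℂ) * (I * (matsubaraFreq β M i) + e)) *
          (f' ((matsubaraFreq β M i + q₀) ^ 2 + (e + δ e) ^ 2) / ((((matsubaraFreq β M i + q₀) ^ 2 + (e + δ e) ^ 2 : ℝ)) : ℂ) *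
              (I * ((matsubaraFreq β M i + q₀ : ℝ) : ℂ) + ((e + δ e : ℝ) : ℂ)) -
            f' (matsubaraFreq β M i ^ 2 + e ^ 2) / (((matsubaraFreq β M i ^ 2 + e ^ 2 : ℝ)) : ℂ) * (I * (matsubaraFreq β M i) + e))‖ ≤
      1024 / Real.pi * Mf * (768 * ℓ' + 3073 * Mf') * BW * (|q₀| + δmax) / klScale klE0 n := by
  set Λ := klScale klE0 n with hΛdef
  have hΛ : 0 < Λ := klth_klScale_pos n
  have hβ0 : 0 < β := pos_of_klBetaMin_le hβ
  have hMf : 0 ≤ Mf := (norm_nonneg _).trans (hbd 0)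
  have hMf' : 0 ≤ Mf' := (norm_nonneg _).trans (hbd' 0)
  have hr₁ : 0 < Λ / 2 := by positivity
  have hr : 0 < 4 * Λ := by positivity
  have hr' : 0 < 16 * Λ := by positivity
  have hLf'0 : 0 ≤ Lf' := by
    have := hlip' 0 1; have h0 : (0:ℝ) ≤ ‖f' 0 - f' 1‖ := norm_nonneg _; norm_num at this; linarith
  have hℓ' : 0 ≤ ℓ' := by
    have : 0 ≤ ℓ' / Λ ^ 2 := hLf'0.trans hLf'
    rwa [le_div_iff₀ (by positivity), zero_mul] at this
  -- the second propagator in singularity-free form: `g' = f'/s`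
  have hg'supp : ∀ s, (16 * Λ) ^ 2 ≤ s → (fun s : ℝ => f' s / ((s : ℝ) : ℂ)) s = 0 := fun s hs => by
    simp only [hout' s hs, zero_div]
  have hg'lip : ∀ s s', ‖(fun s : ℝ => f' s / ((s : ℝ) : ℂ)) s - (fun s : ℝ => f' s / ((s : ℝ) : ℂ)) s'‖ ≤
      (Lf' / (Λ / 2) ^ 2 + Mf' / (Λ / 2) ^ 4) * |s - s'| := fun s s' =>
    klsp_div_lipschitz hlip' hbd' hin' hr₁ s s'
  have hg'bd : ∀ s, ‖(fun s : ℝ => f' s / ((s : ℝ) : ℂ)) s‖ ≤ Mf' / (Λ / 2) ^ 2 := fun s => klsp_div_norm_le hbd' hin' hr₁ s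
  have hgsupp : ∀ s, (4 * Λ) ^ 2 ≤ s → (fun s : ℝ => f s / ((s : ℝ) : ℂ)) s = 0 := fun s hs => by
    simp only [hout s hs, zero_div]
  -- constants
  set A : ℝ := Mf / (Λ / 2) with hA
  set K : ℝ := 3 * (Lf' / (Λ / 2) ^ 2 + Mf' / (Λ / 2) ^ 4) * (16 * Λ) ^ 2 + Mf' / (Λ / 2) ^ 2 with hK
  have hA0 : 0 ≤ A := by positivity
  have hK0 : 0 ≤ K := by positivity
  set D : ℝ := |q₀| + δmax with hD
  have hD0 : 0 ≤ D := by positivity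
  -- the generic perturbation lemma with `Φ = Φ_{f/s}`, `Ψ = Φ_{f'/s}`
  have main := klsp_discrete_perturb_norm_le
    (Φ := fun k₀ e => f (k₀ ^ 2 + e ^ 2) / (((k₀ ^ 2 + e ^ 2 : ℝ)) : ℂ) * (I * k₀ + e))
    (Ψ := fun k₀ e => f' (k₀ ^ 2 + e ^ 2) / (((k₀ ^ 2 + e ^ 2 : ℝ)) : ℂ) * (I * k₀ + e)) (W := W) (δ := δ)
    hA0 hK0 hBW hr.le hδ0
    (fun k₀ e => klsp_div_propagator_norm_le hbd hin hr₁ k₀ e)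
    (fun k₀ hk e => klsp_zero_of_le_abs_fst hgsupp hr.le hk e)
    (fun k₀ e he => klsp_zero_of_le_abs_snd hgsupp hr.le k₀ he)
    (fun k₀ e k₀' e' => klsp_lipschitz hg'lip hg'bd hg'supp hr' k₀ e k₀' e')
    hWbd hδ q₀ hβ0 M
  refine main.trans ?_
  -- arithmetic
  have hcount := klsp_count_factor_le hβ hn
  rw [← hΛdef] at hcount
  have hKle : K ≤ (3072 * ℓ' + 12292 * Mf') / Λ ^ 2 := by
    have hKeq : K = 3072 * Lf' + 12292 * Mf' / Λ ^ 2 := by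
      rw [hK]; field_simp; ring
    rw [hKeq, add_div]
    have : 3072 * Lf' ≤ 3072 * ℓ' / Λ ^ 2 := by rw [mul_div_assoc]; exact mul_le_mul_of_nonneg_left hLf' (by norm_num)
    linarith
  have hinner : 2 * (4 * Λ) * (BW * A * (K * D)) ≤ 2 * (4 * Λ) * (BW * A * ((3072 * ℓ' + 12292 * Mf') / Λ ^ 2 * D)) := by
    have := mul_le_mul_of_nonneg_right hKle hD0
    have := mul_le_mul_of_nonneg_left this (show 0 ≤ BW * A by positivity)
    exact mul_le_mul_of_nonneg_left this (by positivity)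
  calc (4 * Λ / Real.pi + 3 / β) * (2 * (4 * Λ) * (BW * A * (K * D)))
      ≤ (16 / Real.pi * Λ) * (2 * (4 * Λ) * (BW * A * ((3072 * ℓ' + 12292 * Mf') / Λ ^ 2 * D))) :=
        mul_le_mul hcount hinner (by positivity) (by positivity)
    _ = 1024 / Real.pi * Mf * (768 * ℓ' + 3073 * Mf') * BW * D / Λ := by
        rw [hA]; field_simp; ring

end Cross

end Summit.HubbardSuperconductivity.HubbardSuperconductivity.Theorems.KLRegimeSplit

end
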